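import Summits.Ventures.PercRepro.ProfilePointedTriangleIdentity

/-!
# PercRepro — THE COLOOP LIMIT FOR EVERY UP-SET OF FLATS: THE CONJECTURE (G) AND ITS BRIDGE TO (C1′)
(p10, gen 18; `proofs/P10-AVFULL.md` §26(a))

For a finite matroid `M` on `N = #E` elements and an UP-CLOSED family `U` of flats (`UpFlats`), the SEPARATED
bi-independent sets are `sepSets M U = {Z ∈ BI(M) : cl Z ∈ U, cl (E ∖ Z) ∉ U}`.  CONJECTURE (G) (`FlatUpsetLimit`,
NOT asserted): `Σ_{Z ∈ sepSets M U} (2 #Z − N − 1) ≥ 0` — the separated sets with their flat on the `U`-side have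
average size more than `N / 2`.  Census (gen 18, own code): 0 violations on every up-set of flats of every matroid on
≤ 5 elements and on 139,894 up-sets (principal, two-generated, random) at `n = 6, 7`; the `n = 9` catalogue on kit.

THE BRIDGE (kernel, this file): for a point `p` of `M`, the flats `F` of the deletion `M ＼ p` with `p ∈ cl_M F` form
an up-set `modCut M p` (the modular cut of `p`), and `sepSets (M ＼ p) (modCut M p) = capSets M p`
(`sepSets_delete_modCut`), so (G) at the modular cut of `p` is exactly the coloop limit (C1′) of the captured
profile: `capLimit_of_flatUpsetLimit : FlatUpsetLimit α → CapLimit α`.  So (G) is a strict generalisation of (C1′)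
(the cell's pointed conjecture) to families of flats that are NOT modular cuts.  Also here: `sepSets` is closed under
bi-independent supersets (`mem_sepSets_of_subset`) and complement-free (`sdiff_notMem_sepSets`).  Nothing here asserts
(G) or (C1′).
-/

open scoped Matroid

namespace PercRepro.Cogirth

open Finset ThmH Skew

variable {α : Type} [DecidableEq α] {M : Matroid α} [M.Finite]

/-! ### Flats as finsets, up-sets of flats, the separated sets -/

/-- A flat of `M` as a finset: a subset of the ground set equal to its closure. -/
def IsFlatF (M : Matroid α) [M.Finite] (F : Finset α) : Prop := F ⊆ gr M ∧ clF M F = F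

/-- An up-closed family of flats of `M`. -/
structure UpFlats (M : Matroid α) [M.Finite] (U : Finset (Finset α)) : Prop where
  flat : ∀ F ∈ U, IsFlatF M F
  up : ∀ F ∈ U, ∀ G : Finset α, IsFlatF M G → F ⊆ G → G ∈ U

/-- The bi-independent sets separated by `U`: `cl Z ∈ U` and `cl (E ∖ Z) ∉ U`. -/
noncomputable def sepSets (M : Matroid α) [M.Finite] (U : Finset (Finset α)) : Finset (Finset α) :=
  (biIndepAll M).filter (fun Z => clF M Z ∈ U ∧ clF M (gr M \ Z) ∉ U)

/-- **CONJECTURE (G) (NOT asserted)**: for every finite matroid on `α` and every up-set `U` of its flats,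
`Σ_{Z ∈ sepSets M U} (2 #Z − N − 1) ≥ 0`. -/
def FlatUpsetLimit (α : Type) [DecidableEq α] : Prop :=
  ∀ (M : Matroid α) [M.Finite] (U : Finset (Finset α)), UpFlats M U →
    0 ≤ ∑ Z ∈ sepSets M U, (2 * (Z.card : ℤ) - (gr M).card - 1)

/-- Membership in `sepSets`. -/
theorem mem_sepSets {U : Finset (Finset α)} {Z : Finset α} :
    Z ∈ sepSets M U ↔ Z ∈ biIndepAll M ∧ clF M Z ∈ U ∧ clF M (gr M \ Z) ∉ U := by
  unfold sepSets
  rw [mem_filter]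

/-! ### Closure facts (from Mathlib, through `coe_clF`) -/

omit [DecidableEq α] in
/-- `clF M X ⊆ gr M`. -/
theorem clF_subset_gr_fu (X : Finset α) : clF M X ⊆ gr M := by
  intro x hx
  rw [mem_clF_iff] at hx
  have h := M.closure_subset_ground (X : Set α) hx
  rw [← coe_gr M] at h
  exact_mod_cast h

omit [DecidableEq α] in
/-- The closure is idempotent: `clF M (clF M X) = clF M X`. -/
theorem clF_clF_fu (X : Finset α) : clF M (clF M X) = clF M X := by
  apply coe_injective
  rw [coe_clF, coe_clF, Matroid.closure_closure]

omit [DecidableEq α] in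
/-- `clF M X` is a flat. -/
theorem isFlatF_clF (X : Finset α) : IsFlatF M (clF M X) :=
  ⟨clF_subset_gr_fu X, clF_clF_fu X⟩

omit [DecidableEq α] in
/-- A subset of the ground set lies in its closure. -/
theorem subset_clF_fu {X : Finset α} (hX : X ⊆ gr M) : X ⊆ clF M X := by
  intro x hx
  rw [mem_clF_iff]
  have hXE : (X : Set α) ⊆ M.E := by rw [← coe_gr M]; exact_mod_cast hX
  exact M.subset_closure (X : Set α) hXE hx

omit [DecidableEq α] in
/-- The closure is monotone. -/
theorem clF_mono_fu {X Y : Finset α} (h : X ⊆ Y) : clF M X ⊆ clF M Y :=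
  fun _ hx => mem_clF_of_subset h hx

omit [DecidableEq α] in
/-- A flat containing `X` contains `clF M X`. -/
theorem clF_subset_of_isFlatF {X F : Finset α} (hF : IsFlatF M F) (h : X ⊆ F) : clF M X ⊆ F := by
  rw [← hF.2]
  exact clF_mono_fu h

/-! ### The separated family is an up-set of `BI` and complement-free -/

/-- A bi-independent superset of a separated set is separated. -/
theorem mem_sepSets_of_subset {U : Finset (Finset α)} (hU : UpFlats M U) {Z Z' : Finset α}
    (hZ : Z ∈ sepSets M U) (hZ' : Z' ∈ biIndepAll M) (h : Z ⊆ Z') : Z' ∈ sepSets M U := by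
  rw [mem_sepSets] at hZ ⊢
  obtain ⟨_, hin, hout⟩ := hZ
  refine ⟨hZ', hU.up _ hin _ (isFlatF_clF Z') (clF_mono_fu h), ?_⟩
  intro hcon
  apply hout
  exact hU.up _ hcon _ (isFlatF_clF _) (clF_mono_fu (sdiff_subset_sdiff (Subset.refl _) h))

/-- The complement of a separated set is not separated. -/
theorem sdiff_notMem_sepSets {U : Finset (Finset α)} {Z : Finset α} (hZ : Z ∈ sepSets M U) :
    gr M \ Z ∉ sepSets M U := by
  rw [mem_sepSets] at hZ ⊢
  obtain ⟨hZb, hin, hout⟩ := hZ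
  rintro ⟨_, hin', _⟩
  exact hout hin'

/-! ### The bridge: the modular cut of a point -/

open scoped Classical in
/-- The modular cut of `p`: the flats of the deletion `M ＼ p` whose `M`-closure contains `p`. -/
noncomputable def modCut (M : Matroid α) [M.Finite] (p : α) : Finset (Finset α) :=
  ((gr M).erase p).powerset.filter (fun F => IsFlatF (M ＼ ({p} : Set α)) F ∧ p ∈ clF M F)

open scoped Classical in
/-- Membership in `modCut`. -/
theorem mem_modCut {p : α} {F : Finset α} :
    F ∈ modCut M p ↔ F ⊆ (gr M).erase p ∧ IsFlatF (M ＼ ({p} : Set α)) F ∧ p ∈ clF M F := by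
  unfold modCut
  rw [mem_filter, mem_powerset]

omit [DecidableEq α] in
/-- The ground set of the deletion. -/
theorem coe_gr_delete (p : α) : ((gr (M ＼ ({p} : Set α)) : Finset α) : Set α) = M.E \ {p} := by
  rw [coe_gr]
  rfl

/-- The ground set of the deletion, as a finset: `E ∖ p`. -/
theorem gr_delete (p : α) : gr (M ＼ ({p} : Set α)) = (gr M).erase p := by
  apply coe_injective
  rw [coe_gr_delete, coe_erase, coe_gr]

omit [DecidableEq α] in
/-- The closure in the deletion of a set avoiding `p`: `cl_M X ∖ p`. -/
theorem coe_clF_delete {p : α} {X : Finset α} (hpX : p ∉ X) :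
    ((clF (M ＼ ({p} : Set α)) X : Finset α) : Set α) = M.closure (X : Set α) \ {p} := by
  rw [coe_clF, Matroid.delete_closure_eq_of_disjoint]
  rw [Set.disjoint_singleton_right]
  exact_mod_cast hpX

/-- The closure in the deletion of a set avoiding `p`, as a finset: `(clF M X).erase p`. -/
theorem clF_delete {p : α} {X : Finset α} (hpX : p ∉ X) :
    clF (M ＼ ({p} : Set α)) X = (clF M X).erase p := by
  apply coe_injective
  rw [coe_clF_delete hpX, coe_erase, coe_clF]

omit [DecidableEq α] in
/-- The rank in the deletion of a set avoiding `p` is its rank in `M`. -/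
theorem rk_delete {p : α} {X : Finset α} (hX : X ⊆ gr M) (hpX : p ∉ X) :
    rk (M ＼ ({p} : Set α)) X = rk M X := by
  unfold rk
  rw [Matroid.delete_eq_restrict, Matroid.restrict_eRk_eq]
  intro x hx
  rw [Set.mem_sdiff, Set.mem_singleton_iff]
  refine ⟨?_, fun h => hpX (h ▸ hx)⟩
  rw [← coe_gr M]
  exact_mod_cast hX hx

/-- The modular cut is an up-set of flats of the deletion. -/
theorem upFlats_modCut (p : α) : UpFlats (M ＼ ({p} : Set α)) (modCut M p) where
  flat := fun F hF => (mem_modCut.1 hF).2.1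
  up := by
    intro F hF G hG hFG
    rw [mem_modCut] at hF ⊢
    obtain ⟨_, _, hpF⟩ := hF
    refine ⟨?_, hG, mem_clF_of_subset hFG hpF⟩
    rw [← gr_delete]
    exact hG.1

/-- `p ∈ cl_M (cl_M X ∖ p) ↔ p ∈ cl_M X` for `X ⊆ E ∖ p`. -/
theorem mem_clF_erase_clF_iff {p : α} {X : Finset α} (hX : X ⊆ gr M) (hpX : p ∉ X) :
    p ∈ clF M ((clF M X).erase p) ↔ p ∈ clF M X := by
  constructor
  · intro h
    have h1 : clF M ((clF M X).erase p) ⊆ clF M (clF M X) := clF_mono_fu (erase_subset p _)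
    rw [clF_clF_fu X] at h1
    exact h1 h
  · intro h
    have h1 : X ⊆ (clF M X).erase p := by
      intro x hx
      rw [mem_erase]
      exact ⟨fun hxp => hpX (hxp ▸ hx), subset_clF_fu hX hx⟩
    exact mem_clF_of_subset h1 h

/-- The complement in `E` of a `p`-avoiding set is the complement in `E ∖ p` together with `p`. -/
theorem sdiff_eq_insert_erase_sdiff_of_notMem {p : α} (hp : p ∈ gr M) {Z : Finset α} (hpZ : p ∉ Z) :
    gr M \ Z = insert p ((gr M).erase p \ Z) := by
  ext x
  simp only [mem_sdiff, mem_insert, mem_erase]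
  constructor
  · rintro ⟨hxg, hxZ⟩
    by_cases hxp : x = p
    · exact Or.inl hxp
    · exact Or.inr ⟨⟨hxp, hxg⟩, hxZ⟩
  · rintro (rfl | ⟨⟨_, hxg⟩, hxZ⟩)
    · exact ⟨hp, hpZ⟩
    · exact ⟨hxg, hxZ⟩

/-- For a `p`-avoiding independent set `S`, `S ∪ p` is independent iff `p ∉ cl S`. -/
theorem rk_insert_eq_card_iff {p : α} (hp : p ∈ gr M) {S : Finset α} (hpS : p ∉ S)
    (hSi : rk M S = S.card) : rk M (insert p S) = (insert p S).card ↔ p ∉ clF M S := by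
  have hind : M.Indep (S : Set α) := indep_of_rk_eq_card' hSi
  have hpE : p ∈ M.E := by rw [← coe_gr M]; exact_mod_cast hp
  have h1 := hind.insert_indep_iff_of_notMem (e := p) (by exact_mod_cast hpS)
  rw [← coe_insert] at h1
  constructor
  · intro h
    have h2 := indep_of_rk_eq_card' h
    rw [h1, Set.mem_sdiff] at h2
    rw [mem_clF_iff]
    exact h2.2
  · intro h
    apply rk_eq_card_of_indep
    rw [h1, Set.mem_sdiff]
    refine ⟨hpE, ?_⟩
    rw [mem_clF_iff] at h
    exact h

/-- **THE BRIDGE**: the sets of the deletion `M ＼ p` separated by the modular cut of `p` are exactly the captured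
sets of `(M, p)`. -/
theorem sepSets_delete_modCut {p : α} (hp : p ∈ gr M) :
    sepSets (M ＼ ({p} : Set α)) (modCut M p) = capSets M p := by
  ext Z
  rw [mem_sepSets, mem_capSets, mem_biIndepAll, mem_biIndepAll, gr_delete]
  constructor
  · rintro ⟨⟨hZg, hZr, hZc⟩, hin, hout⟩
    have hpZ : p ∉ Z := fun h => (mem_erase.1 (hZg h)).1 rfl
    have hZg' : Z ⊆ gr M := hZg.trans (erase_subset p _)
    have hcomp : (gr M).erase p \ Z ⊆ (gr M).erase p := sdiff_subset
    have hpc : p ∉ (gr M).erase p \ Z := fun h => (mem_erase.1 (mem_sdiff.1 h).1).1 rfl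
    rw [rk_delete hZg' hpZ] at hZr
    rw [rk_delete (hcomp.trans (erase_subset p _)) hpc] at hZc
    rw [mem_modCut, clF_delete hpZ] at hin
    rw [mem_modCut, clF_delete hpc] at hout
    refine ⟨⟨⟨hZg', hZr, ?_⟩, hpZ⟩, (mem_clF_erase_clF_iff hZg' hpZ).1 hin.2.2⟩
    rw [sdiff_eq_insert_erase_sdiff_of_notMem hp hpZ]
    rw [rk_insert_eq_card_iff hp hpc hZc]
    intro hcon
    apply hout
    refine ⟨?_, ?_, (mem_clF_erase_clF_iff (hcomp.trans (erase_subset p _)) hpc).2 hcon⟩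
    · intro x hx
      rw [mem_erase] at hx ⊢
      exact ⟨hx.1, clF_subset_gr_fu _ hx.2⟩
    · rw [← clF_delete hpc]
      exact isFlatF_clF _
  · rintro ⟨⟨⟨hZg, hZr, hZc⟩, hpZ⟩, hcl⟩
    have hZg' : Z ⊆ (gr M).erase p := by
      intro x hx
      rw [mem_erase]
      exact ⟨fun h => hpZ (h ▸ hx), hZg hx⟩
    have hcomp : (gr M).erase p \ Z ⊆ (gr M).erase p := sdiff_subset
    have hpc : p ∉ (gr M).erase p \ Z := fun h => (mem_erase.1 (mem_sdiff.1 h).1).1 rfl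
    rw [sdiff_eq_insert_erase_sdiff_of_notMem hp hpZ] at hZc
    have hSi : rk M ((gr M).erase p \ Z) = ((gr M).erase p \ Z).card := by
      have hind : M.Indep ((insert p ((gr M).erase p \ Z) : Finset α) : Set α) := indep_of_rk_eq_card' hZc
      apply rk_eq_card_of_indep
      exact hind.subset (by rw [coe_insert]; exact Set.subset_insert _ _)
    rw [rk_insert_eq_card_iff hp hpc hSi] at hZc
    refine ⟨⟨hZg', ?_, ?_⟩, ?_, ?_⟩
    · rw [rk_delete hZg hpZ]; exact hZr
    · rw [rk_delete (hcomp.trans (erase_subset p _)) hpc]; exact hSi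
    · rw [mem_modCut, clF_delete hpZ]
      refine ⟨?_, ?_, (mem_clF_erase_clF_iff hZg hpZ).2 hcl⟩
      · intro x hx
        rw [mem_erase] at hx ⊢
        exact ⟨hx.1, clF_subset_gr_fu _ hx.2⟩
      · rw [← clF_delete hpZ]
        exact isFlatF_clF _
    · rw [mem_modCut, clF_delete hpc]
      rintro ⟨_, _, hcon⟩
      exact hZc ((mem_clF_erase_clF_iff (hcomp.trans (erase_subset p _)) hpc).1 hcon)

/-- The deletion of a point has one element fewer. -/
theorem card_gr_delete {p : α} (hp : p ∈ gr M) : (gr (M ＼ ({p} : Set α))).card = (gr M).card - 1 := by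
  rw [gr_delete, card_erase_of_mem hp]

/-- **(G) ⟹ (C1′)**: the conjecture for every up-set of flats gives the coloop limit of the captured profile at
every point. -/
theorem capLimit_of_flatUpsetLimit (h : FlatUpsetLimit α) : CapLimit α := by
  intro M _ p hp
  rw [capLimit_body_iff_sum_nonneg]
  have h1 := h (M ＼ ({p} : Set α)) (modCut M p) (upFlats_modCut p)
  rw [sepSets_delete_modCut hp, card_gr_delete hp] at h1
  have hN : 1 ≤ (gr M).card := card_pos.2 ⟨p, hp⟩
  have h2 : ∑ Z ∈ capSets M p, (2 * (Z.card : ℤ) - (((gr M).card - 1 : ℕ) : ℤ) - 1) =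
      ∑ Z ∈ capSets M p, (2 * (Z.card : ℤ) - (gr M).card) := by
    apply sum_congr rfl
    intro Z _
    rw [Nat.cast_sub hN]
    push_cast
    ring
  rw [h2] at h1
  exact h1

end PercRepro.Cogirth
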